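import Mathlib
import HarnessLib
import Summits.HubbardSuperconductivity.HubbardSuperconductivity.Theorems.KLProgrammeKLRegimeEnginePairTransferRelResStep
import Summits.HubbardSuperconductivity.HubbardSuperconductivity.Theorems.KLProgrammeKLRegimeEnginePairLadderRelativeFlowRates

/-!
# Route `KLProgramme` — ENGINE child gen 8 (stmt-HubbardSuperconductivity-20437 `KLRegimeEngineV17F2`), skeleton v2 class #5 rev 3 (RELATIVE family, INDEX form):
# the Ẽ-form keyed step over the RESOLVED door — **`pairTransferRelRes_succ_keyed_resolved`**
# (cell gate-hubbard-kl, seat hubbard-kl-k3c1-p1 g15, technique «composed-map remainder propagation»; row 58 of CLASS5-RESOLVED-STEP.md, evidence #55 on 20437)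

WHY.  `pairTransferRelRes_succ_keyed` (p594243) keys the class-#5 STEP on `kltc_relative_flow_duhamel`, whose sizes bundle carries, per pair class, the rate `β′`,
`m·β′ ≤ 1/3`, the cumulative-weight profiles `‖bᵢ(t) − bᵢ(0)‖ ≤ ρᵢ`, the Riccati-defect SUPS `ξ₁ ξ₂`, the relative-source SUP `ξ`, the start sup `δ`, and the input row
`S ≥ T₀ + FT_ρ[I] + (4/3)(δe^{2mβ′} + 2ξ)β′(8/3)(ξ₁+ξ₂)` — the sup entries behind the located «(X).3-PH-CUBIC-SLOT».  THIS FILE is the same keyed step over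
`kltc_relative_flow_duhamel_resolved_of_rates` (p636234): identical binders (the nine pinning equations of `pairTransferRelAt_succ_keyed`, the history clause, `Z ≠ 0`),
identical conclusion, and a SIZES bundle WITHOUT `β′ δ ξ ξ₁ ξ₂` and their five rows: per class {a priori ×2; INTEGRATED RATE PROFILES `∫₀¹‖ḃᵢ(τ,c)‖dτ ≤ ρᵢ(c)` (in the
model `ρᵢ := klRungProfile`, `klmf_integral_norm_rate_le_klRungProfile` p636481) with `m·Σρᵢ ≤ 1/3`; history a priori; the (F)(i) re-frame rows `ηr η₁ η₂ d`; the start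
majorant `T₀`; the RESOLVED source integral `I ≥ ∫₀¹‖X_rel‖` (member defects only convolved against the relative weight, `kltc_relSource_resolved_le`); `S ≥ T₀ + I`;
`FT_ρ[S] ≤ Rb` on the ball}.  Plumbing over landed doors; nothing about the model's sizes is asserted; nothing asserts (X).3, (c), K3 or superconductivity.  0 kit · 0 lit.
-/

noncomputable section

namespace Summit.HubbardSuperconductivity.HubbardSuperconductivity.Theorems.KLRegimeSplit

set_option linter.dupNamespace false -- summit = problem name (single-conjunct summit), D-0017

open Finset Matrix Set Literature.MathematicalPhysics.QuantumLattice Literature.Probability.LatticeModels GrassmannAlgebra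
open Summit.HubbardSuperconductivity.HubbardSuperconductivity.Theorems.KLProgrammeCooperResummation
open Summit.HubbardSuperconductivity.HubbardSuperconductivity.Theorems.KLProgrammeLegKernels
open Summit.HubbardSuperconductivity.HubbardSuperconductivity.Theorems.DispersionFlow
open Summit.HubbardSuperconductivity.HubbardSuperconductivity.Theorems.KLRegimeWick

section KeyedResolved

variable (L M : ℕ) [NeZero L] [NeZero M]

set_option maxHeartbeats 1600000 in -- very long hypothesis bundle (nine pinning equations); plumbing into `kltc_relative_flow_duhamel_resolved_of_rates`
/-- **`pairTransferRelRes_succ_keyed_resolved`** — the class-#5 rev-3 producer step in RELATIVE-RESIDUE form over the RESOLVED door (see the module docstring). -/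
theorem pairTransferRelRes_succ_keyed_resolved {β U μ : ℝ} {n : ℕ} {m : ℝ} (hm : 0 ≤ m) {ψ₁ ψ₂ χ₁ χ₂ : FreqMomentum L M → ℝ}
    {Rb Rh : TorusSite 2 L → TorusSite 2 L → TorusSite 2 L → ℝ}
    (hhist : ∀ Qm : TorusSite 2 L, IsPairClassAt L Qm n → ∀ k ∈ klBall L μ 0, ∀ k' ∈ klBall L μ 0,
      ‖(klMemberArrayF L M β U μ n χ₁ Qm + klMemberArrayF L M β U μ n χ₁ Qm *
          diagonal (fun c => -(((klTransferWeight L M β μ (klFlowFrameU L M β U μ n) n χ₁ Qm c -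
            klTransferWeight L M β μ (klFlowFrameU L M β U μ n) n χ₂ Qm c : ℝ)) : ℂ)) * klMemberArrayF L M β U μ n χ₂ Qm -
          klMemberArrayF L M β U μ n χ₂ Qm) k k'‖ ≤ Rh Qm k k')
    (hZ : ∀ Λ ∈ Icc (klScale klE0 (n + 1)) (klScale klE0 n), hubbardEffPartitionFnCT L M β U μ 0 (klFlowFrameU L M β U μ (n + 1)) Λ ≠ 0)
    (A₁ A₁' A₂ A₂' : TorusSite 2 L → ℝ → Matrix (TorusSite 2 L) (TorusSite 2 L) ℂ) (b₁ b₁' b₂ b₂' : TorusSite 2 L → ℝ → TorusSite 2 L → ℂ)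
    (a : TorusSite 2 L → ℝ → TorusSite 2 L → ℂ)
    (hA₁def : A₁ = fun Qm t => Matrix.of fun k k' : TorusSite 2 L => if k ∈ klBall L μ 0 ∧ k' ∈ klBall L μ 0 then
      vertexFn L M β (gaussConv ℂ
        (softCovOf L M β μ (klFlowFrameU L M β U μ (n + 1)) ψ₁ + hubbardCovAboveCT L M β μ 0 (klFlowFrameU L M β U μ (n + 1)) (klScale klE0 (n + 1)) -
          hubbardCovAboveCT L M β μ 0 (klFlowFrameU L M β U μ (n + 1)) (klScale klE0 n + t * (klScale klE0 (n + 1) - klScale klE0 n)))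
        (hubbardEffectiveActionCT L M β U μ 0 (klFlowFrameU L M β U μ (n + 1)) (klScale klE0 n + t * (klScale klE0 (n + 1) - klScale klE0 n)))) 4
        ![(((omega0 M, k'), 0), 0), ((((omega0 M).rev, Qm - k'), 1), 0), ((((omega0 M).rev, Qm - k), 1), 1), (((omega0 M, k), 0), 1)]
      else 0)
    (hA₁'def : A₁' = fun Qm t => Matrix.of fun k k' : TorusSite 2 L => if k ∈ klBall L μ 0 ∧ k' ∈ klBall L μ 0 then
      (klScale klE0 (n + 1) - klScale klE0 n) • -((2 : ℂ)⁻¹ * vertexFn L M β (gaussConv ℂ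
        (softCovOf L M β μ (klFlowFrameU L M β U μ (n + 1)) ψ₁ + hubbardCovAboveCT L M β μ 0 (klFlowFrameU L M β U μ (n + 1)) (klScale klE0 (n + 1)) -
          hubbardCovAboveCT L M β μ 0 (klFlowFrameU L M β U μ (n + 1)) (klScale klE0 n + t * (klScale klE0 (n + 1) - klScale klE0 n)))
        (grassmannDerivPairing ℂ
          (Matrix.of fun X Y : HubbardFieldIdx L M => deriv (fun Λ'' : ℝ => hubbardCovAboveCT L M β μ 0 (klFlowFrameU L M β U μ (n + 1)) Λ'' X Y)
            (klScale klE0 n + t * (klScale klE0 (n + 1) - klScale klE0 n)))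
          (hubbardEffectiveActionCT L M β U μ 0 (klFlowFrameU L M β U μ (n + 1)) (klScale klE0 n + t * (klScale klE0 (n + 1) - klScale klE0 n)))
          (hubbardEffectiveActionCT L M β U μ 0 (klFlowFrameU L M β U μ (n + 1)) (klScale klE0 n + t * (klScale klE0 (n + 1) - klScale klE0 n))))) 4
        ![(((omega0 M, k'), 0), 0), ((((omega0 M).rev, Qm - k'), 1), 0), ((((omega0 M).rev, Qm - k), 1), 1), (((omega0 M, k), 0), 1)])
      else 0)
    (hA₂def : A₂ = fun Qm t => Matrix.of fun k k' : TorusSite 2 L => if k ∈ klBall L μ 0 ∧ k' ∈ klBall L μ 0 then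
      vertexFn L M β (gaussConv ℂ
        (softCovOf L M β μ (klFlowFrameU L M β U μ (n + 1)) ψ₂ + hubbardCovAboveCT L M β μ 0 (klFlowFrameU L M β U μ (n + 1)) (klScale klE0 (n + 1)) -
          hubbardCovAboveCT L M β μ 0 (klFlowFrameU L M β U μ (n + 1)) (klScale klE0 n + t * (klScale klE0 (n + 1) - klScale klE0 n)))
        (hubbardEffectiveActionCT L M β U μ 0 (klFlowFrameU L M β U μ (n + 1)) (klScale klE0 n + t * (klScale klE0 (n + 1) - klScale klE0 n)))) 4
        ![(((omega0 M, k'), 0), 0), ((((omega0 M).rev, Qm - k'), 1), 0), ((((omega0 M).rev, Qm - k), 1), 1), (((omega0 M, k), 0), 1)]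
      else 0)
    (hA₂'def : A₂' = fun Qm t => Matrix.of fun k k' : TorusSite 2 L => if k ∈ klBall L μ 0 ∧ k' ∈ klBall L μ 0 then
      (klScale klE0 (n + 1) - klScale klE0 n) • -((2 : ℂ)⁻¹ * vertexFn L M β (gaussConv ℂ
        (softCovOf L M β μ (klFlowFrameU L M β U μ (n + 1)) ψ₂ + hubbardCovAboveCT L M β μ 0 (klFlowFrameU L M β U μ (n + 1)) (klScale klE0 (n + 1)) -
          hubbardCovAboveCT L M β μ 0 (klFlowFrameU L M β U μ (n + 1)) (klScale klE0 n + t * (klScale klE0 (n + 1) - klScale klE0 n)))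
        (grassmannDerivPairing ℂ
          (Matrix.of fun X Y : HubbardFieldIdx L M => deriv (fun Λ'' : ℝ => hubbardCovAboveCT L M β μ 0 (klFlowFrameU L M β U μ (n + 1)) Λ'' X Y)
            (klScale klE0 n + t * (klScale klE0 (n + 1) - klScale klE0 n)))
          (hubbardEffectiveActionCT L M β U μ 0 (klFlowFrameU L M β U μ (n + 1)) (klScale klE0 n + t * (klScale klE0 (n + 1) - klScale klE0 n)))
          (hubbardEffectiveActionCT L M β U μ 0 (klFlowFrameU L M β U μ (n + 1)) (klScale klE0 n + t * (klScale klE0 (n + 1) - klScale klE0 n))))) 4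
        ![(((omega0 M, k'), 0), 0), ((((omega0 M).rev, Qm - k'), 1), 0), ((((omega0 M).rev, Qm - k), 1), 1), (((omega0 M, k), 0), 1)])
      else 0)
    (hb₁def : b₁ = fun Qm t p => -((klBubbleMass L M β μ (klFlowFrameU L M β U μ (n + 1))
        (fun k => ψ₁ k + (hubbardCutoffWeightCT L M β μ (klFlowFrameU L M β U μ (n + 1)) (klScale klE0 (n + 1)) k -
          hubbardCutoffWeightCT L M β μ (klFlowFrameU L M β U μ (n + 1)) (klScale klE0 n + t * (klScale klE0 (n + 1) - klScale klE0 n)) k))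
        (fun k => ψ₁ k + (hubbardCutoffWeightCT L M β μ (klFlowFrameU L M β U μ (n + 1)) (klScale klE0 (n + 1)) k -
          hubbardCutoffWeightCT L M β μ (klFlowFrameU L M β U μ (n + 1)) (klScale klE0 n + t * (klScale klE0 (n + 1) - klScale klE0 n)) k)) Qm p : ℝ) : ℂ))
    (hb₁'def : b₁' = fun Qm t p => (((klScale klE0 (n + 1) - klScale klE0 n) *
        (klBubbleMass L M β μ (klFlowFrameU L M β U μ (n + 1))
            (fun k => deriv (fun Λ' => hubbardCutoffWeightCT L M β μ (klFlowFrameU L M β U μ (n + 1)) Λ' k) (klScale klE0 n + t * (klScale klE0 (n + 1) - klScale klE0 n)))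
            (fun k => ψ₁ k + (hubbardCutoffWeightCT L M β μ (klFlowFrameU L M β U μ (n + 1)) (klScale klE0 (n + 1)) k -
          hubbardCutoffWeightCT L M β μ (klFlowFrameU L M β U μ (n + 1)) (klScale klE0 n + t * (klScale klE0 (n + 1) - klScale klE0 n)) k)) Qm p +
          klBubbleMass L M β μ (klFlowFrameU L M β U μ (n + 1))
            (fun k => ψ₁ k + (hubbardCutoffWeightCT L M β μ (klFlowFrameU L M β U μ (n + 1)) (klScale klE0 (n + 1)) k -
          hubbardCutoffWeightCT L M β μ (klFlowFrameU L M β U μ (n + 1)) (klScale klE0 n + t * (klScale klE0 (n + 1) - klScale klE0 n)) k))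
            (fun k => deriv (fun Λ' => hubbardCutoffWeightCT L M β μ (klFlowFrameU L M β U μ (n + 1)) Λ' k) (klScale klE0 n + t * (klScale klE0 (n + 1) - klScale klE0 n)))
            Qm p) : ℝ) : ℂ))
    (hb₂def : b₂ = fun Qm t p => -((klBubbleMass L M β μ (klFlowFrameU L M β U μ (n + 1))
        (fun k => ψ₂ k + (hubbardCutoffWeightCT L M β μ (klFlowFrameU L M β U μ (n + 1)) (klScale klE0 (n + 1)) k -
          hubbardCutoffWeightCT L M β μ (klFlowFrameU L M β U μ (n + 1)) (klScale klE0 n + t * (klScale klE0 (n + 1) - klScale klE0 n)) k))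
        (fun k => ψ₂ k + (hubbardCutoffWeightCT L M β μ (klFlowFrameU L M β U μ (n + 1)) (klScale klE0 (n + 1)) k -
          hubbardCutoffWeightCT L M β μ (klFlowFrameU L M β U μ (n + 1)) (klScale klE0 n + t * (klScale klE0 (n + 1) - klScale klE0 n)) k)) Qm p : ℝ) : ℂ))
    (hb₂'def : b₂' = fun Qm t p => (((klScale klE0 (n + 1) - klScale klE0 n) *
        (klBubbleMass L M β μ (klFlowFrameU L M β U μ (n + 1))
            (fun k => deriv (fun Λ' => hubbardCutoffWeightCT L M β μ (klFlowFrameU L M β U μ (n + 1)) Λ' k) (klScale klE0 n + t * (klScale klE0 (n + 1) - klScale klE0 n)))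
            (fun k => ψ₂ k + (hubbardCutoffWeightCT L M β μ (klFlowFrameU L M β U μ (n + 1)) (klScale klE0 (n + 1)) k -
          hubbardCutoffWeightCT L M β μ (klFlowFrameU L M β U μ (n + 1)) (klScale klE0 n + t * (klScale klE0 (n + 1) - klScale klE0 n)) k)) Qm p +
          klBubbleMass L M β μ (klFlowFrameU L M β U μ (n + 1))
            (fun k => ψ₂ k + (hubbardCutoffWeightCT L M β μ (klFlowFrameU L M β U μ (n + 1)) (klScale klE0 (n + 1)) k -
          hubbardCutoffWeightCT L M β μ (klFlowFrameU L M β U μ (n + 1)) (klScale klE0 n + t * (klScale klE0 (n + 1) - klScale klE0 n)) k))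
            (fun k => deriv (fun Λ' => hubbardCutoffWeightCT L M β μ (klFlowFrameU L M β U μ (n + 1)) Λ' k) (klScale klE0 n + t * (klScale klE0 (n + 1) - klScale klE0 n)))
            Qm p) : ℝ) : ℂ))
    (hadef : a = fun Qm t p => (b₁ Qm t p - b₂ Qm t p) +
      (-(((klTransferWeight L M β μ (klFlowFrameU L M β U μ (n + 1)) (n + 1) ψ₁ Qm p - klTransferWeight L M β μ (klFlowFrameU L M β U μ (n + 1)) (n + 1) ψ₂ Qm p : ℝ)) : ℂ) -
        (b₁ Qm 1 p - b₂ Qm 1 p)))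
    (hdata : ∀ Qm : TorusSite 2 L, IsPairClassAt L Qm (n + 1) →
      ∃ (ρ₁ ρ₂ : TorusSite 2 L → ℝ) (ηr η₁ η₂ T₀ I S : TorusSite 2 L → TorusSite 2 L → ℝ) (d : TorusSite 2 L → ℝ),
        -- a priori sizes of the two member arrays along the slice
        (∀ t ∈ Icc (0 : ℝ) 1, ∀ x y, ‖A₁ Qm t x y‖ ≤ m) ∧ (∀ t ∈ Icc (0 : ℝ) 1, ∀ x y, ‖A₂ Qm t x y‖ ≤ m) ∧
        -- INTEGRATED RATE PROFILES of the two rung weights and their smallness (in the model `ρᵢ := klRungProfile`, `klmf_integral_norm_rate_le_klRungProfile`)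
        (∀ c, (∫ τ in (0 : ℝ)..1, ‖b₁' Qm τ c‖) ≤ ρ₁ c) ∧ (∀ c, (∫ τ in (0 : ℝ)..1, ‖b₂' Qm τ c‖) ≤ ρ₂ c) ∧
        m * ∑ c, ρ₁ c ≤ 1 / 3 ∧ m * ∑ c, ρ₂ c ≤ 1 / 3 ∧
        -- the history arrays' a priori size and the START RE-FRAME majorants ((F)(i) lane) against the history objects at frame `K_n`
        (∀ x y, ‖klMemberArrayF L M β U μ n χ₁ Qm x y‖ ≤ m) ∧
        (∀ x y, ‖((A₁ Qm 0 - klMemberArrayF L M β U μ n χ₁ Qm) - (A₂ Qm 0 - klMemberArrayF L M β U μ n χ₂ Qm)) x y‖ ≤ ηr x y) ∧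
        (∀ x y, ‖(A₁ Qm 0 - klMemberArrayF L M β U μ n χ₁ Qm) x y‖ ≤ η₁ x y) ∧
        (∀ x y, ‖(A₂ Qm 0 - klMemberArrayF L M β U μ n χ₂ Qm) x y‖ ≤ η₂ x y) ∧
        (∀ c, ‖a Qm 0 c - -(((klTransferWeight L M β μ (klFlowFrameU L M β U μ n) n χ₁ Qm c -
            klTransferWeight L M β μ (klFlowFrameU L M β U μ n) n χ₂ Qm c : ℝ)) : ℂ)‖ ≤ d c) ∧
        -- the start residue majorant (history bar + re-frame terms; NO convolution of the bar)
        (∀ x y, (if x ∈ klBall L μ 0 ∧ y ∈ klBall L μ 0 then Rh Qm x y else 0) +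
            ηr x y + m * ∑ c, η₁ x c * ‖a Qm 0 c‖ + m * m * ∑ c, d c +
            m * ∑ c, ‖(-(((klTransferWeight L M β μ (klFlowFrameU L M β U μ n) n χ₁ Qm c -
            klTransferWeight L M β μ (klFlowFrameU L M β U μ n) n χ₂ Qm c : ℝ)) : ℂ))‖ * η₂ c y ≤ T₀ x y) ∧
        -- the RESOLVED slice integral of the relative source (member defects only convolved against the relative weight: `kltc_relSource_resolved_le`)
        (∀ x y, (∫ t in (0 : ℝ)..1, ‖((A₁' Qm t + A₁ Qm t * diagonal (b₁' Qm t) * A₁ Qm t) * (1 + diagonal (a Qm t) * A₂ Qm t) +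
            A₁ Qm t * diagonal (a Qm t) * (A₂' Qm t + A₂ Qm t * diagonal (b₂' Qm t) * A₂ Qm t) - (A₂' Qm t + A₂ Qm t * diagonal (b₂' Qm t) * A₂ Qm t)) x y‖) ≤ I x y) ∧
        -- the input majorant: start + source (NO Bethe–Salpeter defects, NO a priori sup, NO sup of the source, ONE dressing)
        (∀ x y, T₀ x y + I x y ≤ S x y) ∧
        -- the private bar at `n+1` dominates the four-term form of `S` on the bare ball
        (∀ k ∈ klBall L μ 0, ∀ k' ∈ klBall L μ 0, S k k' + ∑ c, S k c * ρ₂ c * (3 / 2 * m) + ∑ a', 3 / 2 * m * ρ₁ a' * S a' k' +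
          ∑ a', ∑ c, 3 / 2 * m * ρ₁ a' * S a' c * ρ₂ c * (3 / 2 * m) ≤ Rb Qm k k')) :
    ∀ Qm : TorusSite 2 L, IsPairClassAt L Qm (n + 1) → ∀ k ∈ klBall L μ 0, ∀ k' ∈ klBall L μ 0,
      ‖(klMemberArrayF L M β U μ (n + 1) ψ₁ Qm + klMemberArrayF L M β U μ (n + 1) ψ₁ Qm *
          diagonal (fun p => -(((klTransferWeight L M β μ (klFlowFrameU L M β U μ (n + 1)) (n + 1) ψ₁ Qm p -
            klTransferWeight L M β μ (klFlowFrameU L M β U μ (n + 1)) (n + 1) ψ₂ Qm p : ℝ)) : ℂ)) * klMemberArrayF L M β U μ (n + 1) ψ₂ Qm -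
        klMemberArrayF L M β U μ (n + 1) ψ₂ Qm) k k'‖ ≤ Rb Qm k k' := by
  intro Qm hQm k hk k' hk'
  obtain ⟨ρ₁, ρ₂, ηr, η₁, η₂, T₀, I, S, d, hA₁m, hA₂m, hV₁, hV₂, hZ₁, hZ₂, hH₁, hηr, hη₁, hη₂, hd, hT₀, hI, hS, hbud⟩ := hdata Qm hQm
  -- the two members' flow data (calculus by name)
  obtain ⟨hdA₁, hcA₁, hA₁1, -⟩ := klmf_memberArray_flowData L M β U μ (klFlowFrameU L M β U μ (n + 1)) n ψ₁ Qm hZ (A₁ Qm) (A₁' Qm)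
    (by rw [hA₁def]) (by rw [hA₁'def])
  obtain ⟨hdA₂, hcA₂, hA₂1, -⟩ := klmf_memberArray_flowData L M β U μ (klFlowFrameU L M β U μ (n + 1)) n ψ₂ Qm hZ (A₂ Qm) (A₂' Qm)
    (by rw [hA₂def]) (by rw [hA₂'def])
  obtain ⟨hdb₁, hcb₁, hb₁e⟩ := klmf_rung_data L M β μ (klFlowFrameU L M β U μ (n + 1)) n ψ₁ Qm (b₁ Qm) (b₁' Qm) (by rw [hb₁def]) (by rw [hb₁'def])
  obtain ⟨hdb₂, hcb₂, hb₂e⟩ := klmf_rung_data L M β μ (klFlowFrameU L M β U μ (n + 1)) n ψ₂ Qm (b₂ Qm) (b₂' Qm) (by rw [hb₂def]) (by rw [hb₂'def])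
  obtain ⟨hda, ha1, -⟩ := klmf_relWeight_data L M β μ (klFlowFrameU L M β U μ (n + 1)) n ψ₁ ψ₂ Qm (b₁ Qm) (b₂ Qm) (b₁' Qm) (b₂' Qm) (a Qm)
    hdb₁ hdb₂ hb₁e hb₂e (by rw [hadef])
  obtain ⟨hflow₁, hS₁c⟩ := klmf_riccati_of_defect (A₁ Qm) (A₁' Qm) _ (b₁' Qm) hdA₁ hcA₁ hcb₁ rfl
  obtain ⟨hflow₂, hS₂c⟩ := klmf_riccati_of_defect (A₂ Qm) (A₂' Qm) _ (b₂' Qm) hdA₂ hcA₂ hcb₂ rfl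
  -- the history residue bound, globally (zero off the ball)
  have hQmn : IsPairClassAt L Qm n := isPairClassAt_mono (L := L) hQm (Nat.le_succ n)
  have hEh : ∀ x y, ‖(klMemberArrayF L M β U μ n χ₁ Qm + klMemberArrayF L M β U μ n χ₁ Qm *
      diagonal (fun c => -(((klTransferWeight L M β μ (klFlowFrameU L M β U μ n) n χ₁ Qm c -
        klTransferWeight L M β μ (klFlowFrameU L M β U μ n) n χ₂ Qm c : ℝ)) : ℂ)) * klMemberArrayF L M β U μ n χ₂ Qm -
      klMemberArrayF L M β U μ n χ₂ Qm) x y‖ ≤ (if x ∈ klBall L μ 0 ∧ y ∈ klBall L μ 0 then Rh Qm x y else 0) := by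
    intro x y
    by_cases hxy : x ∈ klBall L μ 0 ∧ y ∈ klBall L μ 0
    · rw [if_pos hxy]; exact hhist Qm hQmn x hxy.1 y hxy.2
    · rw [if_neg hxy, kltc_relResidue_eq_zero_off _ _ _ (klBall L μ 0) (fun x y h => klMemberArrayF_eq_zero_off β U μ n χ₁ Qm h)
        (fun x y h => klMemberArrayF_eq_zero_off β U μ n χ₂ Qm h) hxy, norm_zero]
  -- the start residue by perturbation (no inverse)
  have hE0 : ∀ x y, ‖(A₁ Qm 0 + A₁ Qm 0 * diagonal (a Qm 0) * A₂ Qm 0 - A₂ Qm 0) x y‖ ≤ T₀ x y := fun x y =>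
    (kltc_relResidue_perturb_le _ _ _ _ _ _ (fun x y => if x ∈ klBall L μ 0 ∧ y ∈ klBall L μ 0 then Rh Qm x y else 0) ηr η₁ η₂ d hm
      hH₁ (hA₂m 0 ⟨le_rfl, zero_le_one⟩) hEh hηr hη₁ hη₂ hd x y).trans (hT₀ x y)
  -- the resolved door keyed on integrated rate profiles
  have hfin := kltc_relative_flow_duhamel_resolved_of_rates _ _ _ _ _ _ _ _ _ ρ₁ ρ₂ I S hm hdA₁ hdA₂ hda hcb₁ hcb₂ hS₁c hS₂c
    hflow₁ hflow₂ hA₁m hA₂m hV₁ hV₂ hZ₁ hZ₂ hI (fun x y => (add_le_add (hE0 x y) le_rfl).trans (hS x y)) k k'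
  rw [hA₁1, hA₂1, klmf_ballArray_succ_eq_klMemberArrayF, klmf_ballArray_succ_eq_klMemberArrayF, ha1] at hfin
  exact hfin.trans (hbud k hk k' hk')

end KeyedResolved

end Summit.HubbardSuperconductivity.HubbardSuperconductivity.Theorems.KLRegimeSplit

end
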